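/-
Copyright (c) 2026. All rights reserved.
Released under Apache 2.0 license as described in the file LICENSE.
Authors: HodgeCM-Mathlib publication cell (pub/hodgecm-mathlib), floor-0 programme P4, seat F0P4-p06 (S4a lead).
-/
import Literature.NumberTheory.GelbartRogawski1991.LocalLineIsometryNaturalityHolds
import Literature.NumberTheory.GelbartRogawski1991.LocalLineModelTransport
import HarnessLib

/-!
# The local line isometry INTERTWINES the Weil representations of `U(diag dV)(F_v)` at two hermitian lines of the same class

Topic `NumberTheory/GelbartRogawski1991`; namespace `Literature.NumberTheory.GelbartRogawski1991.UnitaryDualPair.LocalSplitting`.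
KERNEL ONLY: theorems; no definition, no named fact, no `sorry`.  Cell hodgecm-mathlib, crux H413 (stmt-HodgeConjecture-24833),
stub S4a `StubT3aLineTransportAt` / line-class transport `lineClassTransport_equiv`, road (C): the LOCAL EQUIVALENCES that the tree's
gluing ★ `IsRestrictedTensorProductRep.exists_equiv_of_forall_equiv` consumes.

Setting (all at the enumeration `Equiv.prodUnique (Fin N) (Fin 1)`, so that both lines' Schrödinger models live on the SAME
`𝒮(F_vᴺ)`): `L` CM, a real frame `dV` of rank `N ≥ 1`, a splitting Hecke character `θ` (`IsSplittingChar L 1 θ`), two lines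
`a₁, a₂ ∈ (L⁺)ˣ`, a finite place `v` of `L⁺`, and a unit `x` of `L ⊗ L⁺_v` with `a₂⁻¹δ = x xᶜ a₁⁻¹δ` (the witnesses of ★
`QuadraticLocalNormWitnessFamily.exists_localRing_units_lineDelta_eq` when `a₁, a₂` have the same local norm class everywhere).
Let `𝓢_{aᵢ}` be the `θ`-attached CM local family of the big group `U(diag dV ⊗ (aᵢ))` (`congrW … (undoubledSplittings … θ
(borelPlaceMeasure L) (cmFinLocalFamily … θ … (borelPlaceMeasure L)))`, the family of record of the cell's `χ`-line — ★
`UnitaryDualPairChiLineFinRepLocal`), `ω_{aᵢ,v} = 𝓢_{aᵢ}.omegaLoc v` its local Weil representation, and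
`M_x = MoeglinVignerasWaldspurger1987.lineTransportOp … x …` the operator of a metaplectic lift of the line transport `γ_x`
([MoeglinVignerasWaldspurger1987, Chap. 2 II.1 (A)–(B)]).

* **`lineTransportOp_omegaLoc_localLineInl`** — for every `g ∈ U(diag dV)(F_v)` and `Φ ∈ 𝒮(F_vᴺ)`:
  `M_x (ω_{a₁,v}(g ⊗ 1) Φ) = ω_{a₂,v}(g ⊗ 1) (M_x Φ)` — `M_x` is a `U(diag dV)(F_v)`-ISOMORPHISM between the restrictions of the two
  local Weil representations along `k ↦ k ⊗ 1` (`localLineInl`).  Assembly BY NAME of ★ `lineTransportOp_equivariant` (`M_x ω_{s₁}(g) =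
  ω_{q_x s₁ q_x⁻¹}(g) M_x`), ★ S6a `lineTransportSplitting_lineTransportSection_congrW_undoubledSplittings_holds` (`q_x s_{a₁} q_x⁻¹ =
  s_{a₂}` in the common `δ`-model) and ★ `omega_lineTransportSection_finLocalSplittings` (`ω_{s_{aᵢ}} = ω_{aᵢ,v} ∘ (k ↦ k ⊗ 1)`);
* `lineTransportOp_comp_omegaLoc_localLineInl` — the same as an equality of linear maps;
* `lineTransportOp_omegaLoc_localCenter` — the same on the local centres `z · 1` (★ `localLineInl_localCenter`), for any
  presentation `J₁` of `E_v¹`.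

NOT here: the behaviour of `M_x` on the unramified vector `𝟙_{𝒪_vᴺ}` (a.e. an eigenvector — the cell's item (P′3)), and the
gluing over all `v` (the MASTER).  HC_CM is proved only modulo the printed citations until rung 0 closes; this file proves
nothing printed.

## References
* [MoeglinVignerasWaldspurger1987] C. Mœglin, M.-F. Vignéras, J.-L. Waldspurger, LNM 1291 (1987), Chap. 2 II.1 (A)–(B), Chap. 3 I.1–I.3.
* [Kudla1994] S. Kudla, Israel J. Math. 87 (1994), §3 Thm. 3.1.
* [Liu2021] Y. Liu, Camb. J. Math. 9 (2021), App. D §D.1 Step 1 footnote (l. 5215), Lemma D.1 (3) (l. 5233).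
* [GelbartRogawski1991] S. Gelbart, J. Rogawski, Invent. Math. 105 (1991), §3.1 Remark p. 457 L4–13.

ED. 2 (append-only): `lineTransportOp_omegaLoc_localLineInl'` — the same relation for EVERY rank `N` (no `0 < N`; rank `0` is
trivial: `U(diag dV)(F_v)` is then the trivial group), for the consumers quantifying over all ranks.
-/

set_option autoImplicit false

noncomputable section

open scoped Matrix Kronecker
open NumberField IsDedekindDomain
open Literature.RepresentationTheory.HeisenbergGroup
open Literature.RepresentationTheory.MoeglinVignerasWaldspurger1987
open Literature.NumberTheory.Automorphic Literature.NumberTheory.Automorphic.UnitaryGroup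
open Literature.NumberTheory.Weil1964
open Literature.RepresentationTheory.HarrisKudlaSweet1996
open Literature.NumberTheory.GaloisRepresentations
open Literature.NumberTheory.Automorphic.Liu2021.Def411WeilCarriers (TW JW JW_eq isSymm_TW isUnit_det_TW)
open Literature.NumberTheory.Automorphic.Liu2021.Def411WeilCarriersDoubling (lineW complexConj_lineW lineW_ne_zero
  realDiagonal_lineW diagonal_lineW)

namespace Literature.NumberTheory.GelbartRogawski1991.UnitaryDualPair.LocalSplitting

open MeasureTheory
open Literature.NumberTheory.GelbartRogawski1991.GRConstruction (Fp gramR gramR_isSymm isUnit_det_gramR₀ congrW undoubledSplittings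
  cmFinLocalFamily borelPlaceMeasure)

variable (L : Type) [Field L] [NumberField L] [IsCMField L] {N : ℕ}
  (dV : Fin N → L) (hdV : ∀ i, IsCMField.complexConj L (dV i) = dV i) (hdV0 : ∀ i, dV i ≠ 0)
  (v : HeightOneSpectrum (𝓞 (Fp L))) (hN : 0 < N)
  (θ : HeckeCharacter L) (hθ : IsSplittingChar L 1 θ) (a₁ a₂ : (Fp L)ˣ) (x : (LocalRing L v)ˣ)
  (hx : algebraMap L (LocalRing L v) (algebraMap (Fp L) L (↑a₂⁻¹ : Fp L) * imagUnit L) =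
    (x : LocalRing L v) * conjLocal L (IsCMField.complexConj L) v x *
      algebraMap L (LocalRing L v) (algebraMap (Fp L) L (↑a₁⁻¹ : Fp L) * imagUnit L))

set_option maxHeartbeats 800000 in
-- heartbeats: the `FinLocalSplittings` telescopes of the two lines in the statement (as ★ `omega_lineTransportSection_finLocalSplittings`).
/-- **generic form**: for ANY two families `𝓢₁`, `𝓢₂` of local splittings of the big groups at the lines `a₁`, `a₂` whose
`δ`-model sections are related by the line transport (`q_x s_{a₁} q_x⁻¹ = s_{a₂}`, hypothesis `hS` — for the `θ`-attached CM families
this is ★ S6a), the operator `M_x` intertwines `ω₁ ∘ (k ↦ k ⊗ 1)` with `ω₂ ∘ (k ↦ k ⊗ 1)` on `𝒮(F_vᴺ)`.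
[cite: MoeglinVignerasWaldspurger1987, Chap. 2 II.1 (A)–(B); Chap. 3 I.1–I.3] -/
theorem lineTransportOp_omegaLoc_localLineInl_of_eq
    (𝓢₁ : FinLocalSplittings (Fp L) L (IsCMField.complexConj L) N (complexConj_imagUnit L) (imagUnit_ne_zero L)
      (imagUnit_mul_self L) (gram (Fp L) (Equiv.prodUnique (Fin N) (Fin 1)) (realDiagonal L dV hdV) (TW (Fp L) a₁))
      (isSymm_gram (Fp L) (Equiv.prodUnique (Fin N) (Fin 1)) (realDiagonal_isSymm L dV hdV) (isSymm_TW (Fp L) a₁))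
      (reindex_kronecker_eq_gram_map (Fp L) L (Equiv.prodUnique (Fin N) (Fin 1)) (realDiagonal_map L dV hdV).symm
        (JW_eq (Fp L) L a₁)))
    (𝓢₂ : FinLocalSplittings (Fp L) L (IsCMField.complexConj L) N (complexConj_imagUnit L) (imagUnit_ne_zero L)
      (imagUnit_mul_self L) (gram (Fp L) (Equiv.prodUnique (Fin N) (Fin 1)) (realDiagonal L dV hdV) (TW (Fp L) a₂))
      (isSymm_gram (Fp L) (Equiv.prodUnique (Fin N) (Fin 1)) (realDiagonal_isSymm L dV hdV) (isSymm_TW (Fp L) a₂))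
      (reindex_kronecker_eq_gram_map (Fp L) L (Equiv.prodUnique (Fin N) (Fin 1)) (realDiagonal_map L dV hdV).symm
        (JW_eq (Fp L) L a₂)))
    (hS : lineTransportSplitting L v (IsCMField.complexConj L) N (conj_lineDelta (complexConj_imagUnit L) a₁)
        (lineDelta_ne_zero (imagUnit_ne_zero L) a₁) (lineDelta_mul_self (imagUnit_mul_self L) a₁)
        (conj_lineDelta (complexConj_imagUnit L) a₂) (lineDelta_ne_zero (imagUnit_ne_zero L) a₂)
        (lineDelta_mul_self (imagUnit_mul_self L) a₂) x (realDiagonal L dV hdV) (realDiagonal_isSymm L dV hdV)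
        (isUnit_det_realDiagonal L dV hdV hdV0) hx
        (lineTransportSection (Fp L) L (IsCMField.complexConj L) N (complexConj_imagUnit L) (imagUnit_ne_zero L)
          (imagUnit_mul_self L) (realDiagonal L dV hdV) (realDiagonal_isSymm L dV hdV) (Matrix.diagonal dV)
          (realDiagonal_map L dV hdV).symm a₁ v (𝓢₁.s v) (𝓢₁.proj_s v)) =
      lineTransportSection (Fp L) L (IsCMField.complexConj L) N (complexConj_imagUnit L) (imagUnit_ne_zero L)
        (imagUnit_mul_self L) (realDiagonal L dV hdV) (realDiagonal_isSymm L dV hdV) (Matrix.diagonal dV)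
        (realDiagonal_map L dV hdV).symm a₂ v (𝓢₂.s v) (𝓢₂.proj_s v))
    (g : localPi L (IsCMField.complexConj L) N (Matrix.diagonal dV) v)
    (Φ : SchwartzBruhat (Fin N → v.adicCompletion (Fp L))) :
    Literature.RepresentationTheory.MoeglinVignerasWaldspurger1987.lineTransportOp L v (IsCMField.complexConj L) N
        (conj_lineDelta (complexConj_imagUnit L) a₁) (lineDelta_ne_zero (imagUnit_ne_zero L) a₁)
        (lineDelta_mul_self (imagUnit_mul_self L) a₁) (conj_lineDelta (complexConj_imagUnit L) a₂)
        (lineDelta_ne_zero (imagUnit_ne_zero L) a₂) (lineDelta_mul_self (imagUnit_mul_self L) a₂) x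
        (realDiagonal L dV hdV) (realDiagonal_isSymm L dV hdV) (isUnit_det_realDiagonal L dV hdV hdV0) hx
      ((𝓢₁.omegaLoc v)
        (localLineInl L (IsCMField.complexConj L) N (Equiv.prodUnique (Fin N) (Fin 1)) (Matrix.diagonal dV) (JW (Fp L) L a₁) v g)
        Φ) =
      (𝓢₂.omegaLoc v)
        (localLineInl L (IsCMField.complexConj L) N (Equiv.prodUnique (Fin N) (Fin 1)) (Matrix.diagonal dV) (JW (Fp L) L a₂) v g)
        (Literature.RepresentationTheory.MoeglinVignerasWaldspurger1987.lineTransportOp L v (IsCMField.complexConj L) N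
          (conj_lineDelta (complexConj_imagUnit L) a₁) (lineDelta_ne_zero (imagUnit_ne_zero L) a₁)
          (lineDelta_mul_self (imagUnit_mul_self L) a₁) (conj_lineDelta (complexConj_imagUnit L) a₂)
          (lineDelta_ne_zero (imagUnit_ne_zero L) a₂) (lineDelta_mul_self (imagUnit_mul_self L) a₂) x
          (realDiagonal L dV hdV) (realDiagonal_isSymm L dV hdV) (isUnit_det_realDiagonal L dV hdV hdV0) hx Φ) := by
  have h₁ := omega_lineTransportSection_finLocalSplittings (Fp L) L (IsCMField.complexConj L) N (complexConj_imagUnit L)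
    (imagUnit_ne_zero L) (imagUnit_mul_self L) (realDiagonal L dV hdV) (realDiagonal_isSymm L dV hdV) (Matrix.diagonal dV)
    (realDiagonal_map L dV hdV).symm a₁ v 𝓢₁
  have h₂ := omega_lineTransportSection_finLocalSplittings (Fp L) L (IsCMField.complexConj L) N (complexConj_imagUnit L)
    (imagUnit_ne_zero L) (imagUnit_mul_self L) (realDiagonal L dV hdV) (realDiagonal_isSymm L dV hdV) (Matrix.diagonal dV)
    (realDiagonal_map L dV hdV).symm a₂ v 𝓢₂
  have heq := Literature.RepresentationTheory.MoeglinVignerasWaldspurger1987.lineTransportOp_equivariant L v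
    (IsCMField.complexConj L) N (conj_lineDelta (complexConj_imagUnit L) a₁) (lineDelta_ne_zero (imagUnit_ne_zero L) a₁)
    (lineDelta_mul_self (imagUnit_mul_self L) a₁) (conj_lineDelta (complexConj_imagUnit L) a₂)
    (lineDelta_ne_zero (imagUnit_ne_zero L) a₂) (lineDelta_mul_self (imagUnit_mul_self L) a₂) x (realDiagonal L dV hdV)
    (realDiagonal_isSymm L dV hdV) (isUnit_det_realDiagonal L dV hdV hdV0) hx
    (lineTransportSection (Fp L) L (IsCMField.complexConj L) N (complexConj_imagUnit L) (imagUnit_ne_zero L)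
      (imagUnit_mul_self L) (realDiagonal L dV hdV) (realDiagonal_isSymm L dV hdV) (Matrix.diagonal dV)
      (realDiagonal_map L dV hdV).symm a₁ v (𝓢₁.s v) (𝓢₁.proj_s v)) g Φ
  -- chain: `M (ω₁(g⊗1) Φ) = M (ω_{s₁}(g) Φ) = ω_{q s₁ q⁻¹}(g) (M Φ) = ω_{s₂}(g) (M Φ) = ω₂(g⊗1) (M Φ)` (no `rw` through `Mp` products)
  refine (congrArg _ (DFunLike.congr_fun (DFunLike.congr_fun h₁ g) Φ).symm).trans (heq.trans ?_)
  refine Eq.trans ?_ (DFunLike.congr_fun (DFunLike.congr_fun h₂ g) _)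
  exact congrArg (fun s => ((MpPsi.toRep (localSchrodinger (Fp L) N (realDiagonal L dV hdV) v)).comp s) g _) hS

-- heartbeats: the statement spells the two CM local families of record (`congrW … (undoubledSplittings … (cmFinLocalFamily …))`,
-- as in ★ S6a whose statement alone needs 1 600 000); the default budget times out while elaborating it.
set_option maxHeartbeats 1600000 in
include hN hx in
/-- **The line isometry intertwines the two local Weil representations of `U(diag dV)(F_v)`**: for lines `a₁, a₂` of the same
local class at `v` (witness `x`, `a₂⁻¹δ = x xᶜ a₁⁻¹δ`), the operator `M_x` of a metaplectic lift of the transport `γ_x` satisfies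
`M_x (ω_{a₁,v}(g ⊗ 1) Φ) = ω_{a₂,v}(g ⊗ 1) (M_x Φ)` for every `g ∈ U(diag dV)(F_v)`, `Φ ∈ 𝒮(F_vᴺ)`, where `ω_{aᵢ,v}` is the local Weil
representation of the `θ`-attached CM local family at the line `aᵢ`.  [Liu2021, Lem. D.1 (3)]'s «another representative gives an
isomorphic representation», place by place, as an explicit intertwiner.
[cite: MoeglinVignerasWaldspurger1987, Chap. 2 II.1 (A)–(B); Chap. 3 I.1–I.3] [cite: Kudla1994, §3 Thm 3.1]
[cite: Liu2021, App. D Lemma D.1 (3) (l. 5233)] -/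
theorem lineTransportOp_omegaLoc_localLineInl (g : localPi L (IsCMField.complexConj L) N (Matrix.diagonal dV) v)
    (Φ : SchwartzBruhat (Fin N → v.adicCompletion (Fp L))) :
    Literature.RepresentationTheory.MoeglinVignerasWaldspurger1987.lineTransportOp L v (IsCMField.complexConj L) N (conj_lineDelta (complexConj_imagUnit L) a₁)
        (lineDelta_ne_zero (imagUnit_ne_zero L) a₁) (lineDelta_mul_self (imagUnit_mul_self L) a₁)
        (conj_lineDelta (complexConj_imagUnit L) a₂) (lineDelta_ne_zero (imagUnit_ne_zero L) a₂)
        (lineDelta_mul_self (imagUnit_mul_self L) a₂) x (realDiagonal L dV hdV) (realDiagonal_isSymm L dV hdV)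
        (isUnit_det_realDiagonal L dV hdV hdV0) hx
      (((congrW L (Equiv.prodUnique (Fin N) (Fin 1)) dV hdV (lineW L (TW (Fp L) a₁)) (complexConj_lineW L (TW (Fp L) a₁))
            (realDiagonal_lineW L (TW (Fp L) a₁)) (diagonal_lineW L (TW (Fp L) a₁) (JW_eq (Fp L) L a₁))
            (undoubledSplittings L (Equiv.prodUnique (Fin N) (Fin 1)) dV hdV hdV0 (lineW L (TW (Fp L) a₁))
              (complexConj_lineW L (TW (Fp L) a₁)) (lineW_ne_zero L (TW (Fp L) a₁) (isUnit_det_TW (Fp L) a₁)) θ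
              (borelPlaceMeasure L)
              (cmFinLocalFamily L (Equiv.prodUnique (Fin N) (Fin 1)) dV hdV hdV0 (lineW L (TW (Fp L) a₁))
                (complexConj_lineW L (TW (Fp L) a₁)) (lineW_ne_zero L (TW (Fp L) a₁) (isUnit_det_TW (Fp L) a₁)) θ hθ
                (borelPlaceMeasure L)))
            (isSymm_TW (Fp L) a₁) (JW_eq (Fp L) L a₁)).omegaLoc v)
        (localLineInl L (IsCMField.complexConj L) N (Equiv.prodUnique (Fin N) (Fin 1)) (Matrix.diagonal dV) (JW (Fp L) L a₁) v g)
        Φ) =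
      ((congrW L (Equiv.prodUnique (Fin N) (Fin 1)) dV hdV (lineW L (TW (Fp L) a₂)) (complexConj_lineW L (TW (Fp L) a₂))
            (realDiagonal_lineW L (TW (Fp L) a₂)) (diagonal_lineW L (TW (Fp L) a₂) (JW_eq (Fp L) L a₂))
            (undoubledSplittings L (Equiv.prodUnique (Fin N) (Fin 1)) dV hdV hdV0 (lineW L (TW (Fp L) a₂))
              (complexConj_lineW L (TW (Fp L) a₂)) (lineW_ne_zero L (TW (Fp L) a₂) (isUnit_det_TW (Fp L) a₂)) θ
              (borelPlaceMeasure L)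
              (cmFinLocalFamily L (Equiv.prodUnique (Fin N) (Fin 1)) dV hdV hdV0 (lineW L (TW (Fp L) a₂))
                (complexConj_lineW L (TW (Fp L) a₂)) (lineW_ne_zero L (TW (Fp L) a₂) (isUnit_det_TW (Fp L) a₂)) θ hθ
                (borelPlaceMeasure L)))
            (isSymm_TW (Fp L) a₂) (JW_eq (Fp L) L a₂)).omegaLoc v)
        (localLineInl L (IsCMField.complexConj L) N (Equiv.prodUnique (Fin N) (Fin 1)) (Matrix.diagonal dV) (JW (Fp L) L a₂) v g)
        (Literature.RepresentationTheory.MoeglinVignerasWaldspurger1987.lineTransportOp L v (IsCMField.complexConj L) N (conj_lineDelta (complexConj_imagUnit L) a₁)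
          (lineDelta_ne_zero (imagUnit_ne_zero L) a₁) (lineDelta_mul_self (imagUnit_mul_self L) a₁)
          (conj_lineDelta (complexConj_imagUnit L) a₂) (lineDelta_ne_zero (imagUnit_ne_zero L) a₂)
          (lineDelta_mul_self (imagUnit_mul_self L) a₂) x (realDiagonal L dV hdV) (realDiagonal_isSymm L dV hdV)
          (isUnit_det_realDiagonal L dV hdV hdV0) hx Φ) :=
  lineTransportOp_omegaLoc_localLineInl_of_eq L dV hdV hdV0 v a₁ a₂ x hx _ _
    (lineTransportSplitting_lineTransportSection_congrW_undoubledSplittings_holds L dV hdV hdV0 v hN θ hθ a₁ a₂ x hx) g Φ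


-- heartbeats: as above (the statement spells the two CM local families of record).
set_option maxHeartbeats 1600000 in
/-- **ED. 2 — the same intertwining relation for EVERY rank `N`, the hypothesis `0 < N` REMOVED**: in rank `N = 0` the group
`U(diag dV)(F_v) ≤ Π_{w ∣ v} GL₀(L_w)` is trivial, so `g = 1` acts by the identity on both sides and the relation reads `M_x Φ = M_x Φ`;
in rank `N ≥ 1` it is `lineTransportOp_omegaLoc_localLineInl`.  (Needed by the consumers that quantify over all ranks, e.g. P2's
socket (C′) `Def411WeilCarriers.rhoAtLine_lineClassTransport`.)
[cite: MoeglinVignerasWaldspurger1987, Chap. 2 II.1 (A)–(B); Chap. 3 I.1–I.3] [cite: Kudla1994, §3 Thm 3.1]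
[cite: Liu2021, App. D Lemma D.1 (3) (l. 5233)] -/
theorem lineTransportOp_omegaLoc_localLineInl' (g : localPi L (IsCMField.complexConj L) N (Matrix.diagonal dV) v)
    (Φ : SchwartzBruhat (Fin N → v.adicCompletion (Fp L))) :
    Literature.RepresentationTheory.MoeglinVignerasWaldspurger1987.lineTransportOp L v (IsCMField.complexConj L) N (conj_lineDelta (complexConj_imagUnit L) a₁)
        (lineDelta_ne_zero (imagUnit_ne_zero L) a₁) (lineDelta_mul_self (imagUnit_mul_self L) a₁)
        (conj_lineDelta (complexConj_imagUnit L) a₂) (lineDelta_ne_zero (imagUnit_ne_zero L) a₂)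
        (lineDelta_mul_self (imagUnit_mul_self L) a₂) x (realDiagonal L dV hdV) (realDiagonal_isSymm L dV hdV)
        (isUnit_det_realDiagonal L dV hdV hdV0) hx
      (((congrW L (Equiv.prodUnique (Fin N) (Fin 1)) dV hdV (lineW L (TW (Fp L) a₁)) (complexConj_lineW L (TW (Fp L) a₁))
            (realDiagonal_lineW L (TW (Fp L) a₁)) (diagonal_lineW L (TW (Fp L) a₁) (JW_eq (Fp L) L a₁))
            (undoubledSplittings L (Equiv.prodUnique (Fin N) (Fin 1)) dV hdV hdV0 (lineW L (TW (Fp L) a₁))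
              (complexConj_lineW L (TW (Fp L) a₁)) (lineW_ne_zero L (TW (Fp L) a₁) (isUnit_det_TW (Fp L) a₁)) θ
              (borelPlaceMeasure L)
              (cmFinLocalFamily L (Equiv.prodUnique (Fin N) (Fin 1)) dV hdV hdV0 (lineW L (TW (Fp L) a₁))
                (complexConj_lineW L (TW (Fp L) a₁)) (lineW_ne_zero L (TW (Fp L) a₁) (isUnit_det_TW (Fp L) a₁)) θ hθ
                (borelPlaceMeasure L)))
            (isSymm_TW (Fp L) a₁) (JW_eq (Fp L) L a₁)).omegaLoc v)
        (localLineInl L (IsCMField.complexConj L) N (Equiv.prodUnique (Fin N) (Fin 1)) (Matrix.diagonal dV) (JW (Fp L) L a₁) v g)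
        Φ) =
      ((congrW L (Equiv.prodUnique (Fin N) (Fin 1)) dV hdV (lineW L (TW (Fp L) a₂)) (complexConj_lineW L (TW (Fp L) a₂))
            (realDiagonal_lineW L (TW (Fp L) a₂)) (diagonal_lineW L (TW (Fp L) a₂) (JW_eq (Fp L) L a₂))
            (undoubledSplittings L (Equiv.prodUnique (Fin N) (Fin 1)) dV hdV hdV0 (lineW L (TW (Fp L) a₂))
              (complexConj_lineW L (TW (Fp L) a₂)) (lineW_ne_zero L (TW (Fp L) a₂) (isUnit_det_TW (Fp L) a₂)) θ
              (borelPlaceMeasure L)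
              (cmFinLocalFamily L (Equiv.prodUnique (Fin N) (Fin 1)) dV hdV hdV0 (lineW L (TW (Fp L) a₂))
                (complexConj_lineW L (TW (Fp L) a₂)) (lineW_ne_zero L (TW (Fp L) a₂) (isUnit_det_TW (Fp L) a₂)) θ hθ
                (borelPlaceMeasure L)))
            (isSymm_TW (Fp L) a₂) (JW_eq (Fp L) L a₂)).omegaLoc v)
        (localLineInl L (IsCMField.complexConj L) N (Equiv.prodUnique (Fin N) (Fin 1)) (Matrix.diagonal dV) (JW (Fp L) L a₂) v g)
        (Literature.RepresentationTheory.MoeglinVignerasWaldspurger1987.lineTransportOp L v (IsCMField.complexConj L) N (conj_lineDelta (complexConj_imagUnit L) a₁)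
          (lineDelta_ne_zero (imagUnit_ne_zero L) a₁) (lineDelta_mul_self (imagUnit_mul_self L) a₁)
          (conj_lineDelta (complexConj_imagUnit L) a₂) (lineDelta_ne_zero (imagUnit_ne_zero L) a₂)
          (lineDelta_mul_self (imagUnit_mul_self L) a₂) x (realDiagonal L dV hdV) (realDiagonal_isSymm L dV hdV)
          (isUnit_det_realDiagonal L dV hdV hdV0) hx Φ) := by
  rcases Nat.eq_zero_or_pos N with hN0 | hN
  · subst hN0
    have hg : g = 1 :=
      Subtype.ext (funext fun w => Units.ext (Subsingleton.elim _ _))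
    simp only [hg, map_one, Module.End.one_apply]
  · exact lineTransportOp_omegaLoc_localLineInl L dV hdV hdV0 v hN θ hθ a₁ a₂ x hx g Φ

end Literature.NumberTheory.GelbartRogawski1991.UnitaryDualPair.LocalSplitting

end
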